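import Literature.AlgebraicGeometry.HodgeTheory.AbelianVarietyExactEndomorphisms
import Literature.Dynamics.Ergodic.ToralAffineMapsExact
import HarnessLib

/-!
# Exactness of the affine self-maps `P ↦ f(P) · Q` of a complex abelian variety and `y ↦ ρ(M) y + c` of a complex
# torus: an affine map is exact iff its linear part is (Andersen–Thomsen Thm. 4.3; Krzyżewski's criterion)

Lane `lit-hodgefound`, row A1-30⁺ / (`AbelianVarietyExactEndomorphisms`)⁺ / (A1-30⁺³¹ `AbelianVarietyAffineSelfMapsMixing`)⁺
(prover seat `lit-hodgefound-p31`): the lane file of `Literature/Dynamics/Ergodic/ToralAffineMapsExact.lean`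
(`S x = T_A x + c` is an exact endomorphism of `(𝕋^d, Haar)` iff `T_A` is iff no unimodular polynomial divides `χ_A`;
an exact affine map is strong-mixing), read on the tree's complex tori `X = E/Φ(ℤ^ι)` and on the affine self-maps
`g(P) = f(P) · Q` of the complex points `A(ℂ)` of a complex abelian variety (uniformisation
`complexAbelianVariety_torusUniformised_holds`, `exists_mapMatrix_comp_eq_of_hom`,
`semiconj_mapMatrix_add_mapContinuous_mul`; Haar probability measure `eq_map_volume_of_map_mul_right_eq`).

## The printed statements

K. K. S. Andersen, K. Thomsen, *The C\*-algebra of an affine map on the 3-torus*, Doc. Math. 17 (2012) (held text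
arXiv:1204.0224 chunk p0010): **Theorem 4.3** «1) If no unimodular polynomial divides `f_A` every affine local
homeomorphism of `𝕋ⁿ` with `φ_A` as linear part is exact […] 2) […] In this case no affine local homeomorphism with
`φ_A` as linear part is exact», proof: «Note that an affine map is exact if and only if its linear part is»;
**Theorem 4.1** (Krzyżewski, *On exact toral endomorphisms*, Monatsh. Math. 116 (1993)): `φ_A` is exact iff no
unimodular polynomial divides `f_A`.  P. Walters, *An Introduction to Ergodic Theory* (1982), §4.9 Definition 4.14
(exact endomorphism, held chunk p0126: «Exact endomorphisms […] are strong-mixing»), §1.7 Theorem 1.29 (affine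
transformations `T = a · A`: strong-mixing ⟺ `A` ergodic; held chunk p0063).  (Exactness throughout is Rohlin's, for
the Haar probability measure — the tree's `IsExactEndomorphism`.)

## What is formalised (theorems only; no definition, no named fact)

§1 complex tori, `S y = ρ(M) y + c`: **`ComplexTorus.isExactEndomorphism_mapMatrix_add_iff`** (`S` exact ⟺ `ρ(M)`
exact, for EVERY `M`), `ComplexTorus.isExactEndomorphism_mapMatrix_add_iff_forall_not_dvd_charpoly` (`det M ≠ 0`:
⟺ no unimodular polynomial divides `χ_M`), `ComplexTorus.isExactEndomorphism_mapMatrix_add_of_forall_one_lt_norm`,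
`ComplexTorus.not_isExactEndomorphism_mapMatrix_add_of_isUnit_det`,
`ComplexTorus.mixing_mapMatrix_add_of_isExactEndomorphism` (exact ⟹ strong-mixing), `ComplexTorus.mixing_mapMatrix_of_isExactEndomorphism`.
§2 a complex abelian variety `A`, `f : A ⟶ A`, `Q ∈ A(ℂ)`, the Haar probability measure `μ` of `A(ℂ)` and
`g(P) = f(P) · Q`: **`AbelianVariety.isExactEndomorphism_mapContinuous_mul_iff`** (`g` exact ⟺ `f(ℂ)` exact, for
EVERY `f`), **`AbelianVariety.isExactEndomorphism_mapContinuous_mul_iff_forall_not_dvd_charpoly`** (for an isogeny: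
⟺ no unimodular polynomial divides `χ(f(ℂ)^* | H¹(A(ℂ); ℚ))`),
`AbelianVariety.isExactEndomorphism_mapContinuous_mul_of_forall_one_lt_norm`,
`AbelianVariety.not_isExactEndomorphism_mapContinuous_mul_of_isIso`,
**`AbelianVariety.mixing_mapContinuous_mul_of_isExactEndomorphism`** and `AbelianVariety.mixing_mapContinuous_of_isExactEndomorphism`
(an exact `g`, resp. `f(ℂ)`, is strong-mixing).

## References

* [AndersenThomsen2012] K. K. S. Andersen, K. Thomsen, Doc. Math. 17 (2012) 545–572, §4 Theorems 4.1, 4.3 and the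
  proof of 4.3 (held text arXiv:1204.0224 chunk p0010).
* [Krzyzewski1993] K. Krzyżewski, *On exact toral endomorphisms*, Monatsh. Math. 116 (1993) 39–47 (cite-only).
* [Walters1982] P. Walters, *An Introduction to Ergodic Theory*, GTM 79 (1982), §4.9 Definition 4.14 (held text
  chunk p0126), §1.7 Theorem 1.29 (chunk p0063).
* [Lange2023AbelianVarietiesComplex] H. Lange, *Abelian Varieties over the Complex Numbers* (2023), §1.1.2–§1.1.3
  (PDF pp. 19–23).
-/

noncomputable section

-- `ComplexTorus Φ` (for `Φ : ℝ^ι ≃ E`) is the type `ι → ℝ/ℤ = UnitAddTorus ι`; instance paths up to unfolding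
set_option backward.isDefEq.respectTransparency false
-- nested instance problems on the carriers (cf. `AbelianVarietyErgodicEndomorphisms.lean`)
set_option maxSynthPendingDepth 3

open scoped Manifold Topology
open CategoryTheory Module Function Finset MeasureTheory MeasureTheory.Measure Set Filter Polynomial
open Literature.AlgebraicTopology.SingularHomology Literature.NumberTheory.Transcendental
  Literature.NumberTheory.LFunctions Literature.Dynamics.Ergodic
open Literature.AlgebraicGeometry.Motives (ComplexPoints IsSmoothProjective AbelianVariety SchemeOver AlgPoints)

/-! ### §1 The complex torus -/

namespace Literature.Geometry.Kaehler.ComplexTorus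

variable {ι : Type*} [Fintype ι] [DecidableEq ι] {E : Type*} [NormedAddCommGroup E] [NormedSpace ℂ E]
  (Φ : (ι → ℝ) ≃L[ℝ] E)

/-- **«An affine map is exact if and only if its linear part is»** on a complex torus: for EVERY `M ∈ M_ι(ℤ)` and
`c ∈ X = E/Φ(ℤ^ι)`, `y ↦ ρ(M) y + c` is an exact endomorphism (Haar probability measure) iff `ρ(M)` is (for
`det M = 0` neither map preserves the measure, `det_ne_zero_of_measurePreserving_mapMatrix`).
[cite: AndersenThomsen2012, §4 proof of Theorem 4.3 (held text arXiv:1204.0224 chunk p0010)]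
[cite: Walters1982, §4.9 Definition 4.14 (held text chunk p0126)] -/
theorem isExactEndomorphism_mapMatrix_add_iff {M : Matrix ι ι ℤ} (c : ComplexTorus Φ) :
    IsExactEndomorphism (fun y ↦ mapMatrix Φ Φ M y + c) volume ↔ IsExactEndomorphism (mapMatrix Φ Φ M) volume := by
  have hcomp : (fun y : ComplexTorus Φ ↦ y - c) ∘ (fun y ↦ mapMatrix Φ Φ M y + c) = mapMatrix Φ Φ M := by
    funext y
    simp only [Function.comp_apply, add_sub_cancel_right]
  refine ⟨fun h ↦ ?_, fun h ↦ ?_⟩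
  · have hmp : MeasurePreserving (mapMatrix Φ Φ M) volume volume := by
      rw [← hcomp]
      exact (measurePreserving_sub_right volume c).comp h.measurePreserving
    have hM : M.det ≠ 0 := det_ne_zero_of_measurePreserving_mapMatrix Φ hmp
    exact (ToralEndomorphism.isExactEndomorphism_add_const_iff M (T := mapMatrix Φ Φ M) (mapMatrix_apply M) hM c).1 h
  · have hM : M.det ≠ 0 := det_ne_zero_of_measurePreserving_mapMatrix Φ h.measurePreserving
    exact (ToralEndomorphism.isExactEndomorphism_add_const_iff M (T := mapMatrix Φ Φ M) (mapMatrix_apply M) hM c).2 h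

/-- **Andersen–Thomsen, Theorem 4.3 in measure form on a complex torus**: for `det M ≠ 0` and every `c`,
`y ↦ ρ(M) y + c` is an exact endomorphism iff no unimodular polynomial divides `χ_M`.
[cite: AndersenThomsen2012, §4 Theorem 4.3 (1)–(2) with Theorem 4.1 (held text arXiv:1204.0224 chunk p0010)]
[cite: Krzyzewski1993, Theorem (abstract)] -/
theorem isExactEndomorphism_mapMatrix_add_iff_forall_not_dvd_charpoly {M : Matrix ι ι ℤ} (hM : M.det ≠ 0)
    (c : ComplexTorus Φ) :
    IsExactEndomorphism (fun y ↦ mapMatrix Φ Φ M y + c) volume ↔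
      ∀ g : ℤ[X], g.Monic → 0 < g.natDegree → IsUnit (g.coeff 0) → ¬ g ∣ M.charpoly :=
  ToralEndomorphism.isExactEndomorphism_add_const_iff_forall_not_dvd_charpoly M (T := mapMatrix Φ Φ M)
    (mapMatrix_apply M) hM c

/-- **Expanding affine maps of a complex torus are exact**: all complex eigenvalues of `M` of modulus `> 1` ⟹ every
`y ↦ ρ(M) y + c` is an exact endomorphism. [cite: AndersenThomsen2012, §4 Theorem 4.3 (1) (held text arXiv:1204.0224 chunk p0010)] -/
theorem isExactEndomorphism_mapMatrix_add_of_forall_one_lt_norm {M : Matrix ι ι ℤ}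
    (hexp : ∀ α ∈ (M.map (Int.castRingHom ℂ)).charpoly.roots, 1 < ‖α‖) (c : ComplexTorus Φ) :
    IsExactEndomorphism (fun y ↦ mapMatrix Φ Φ M y + c) volume :=
  ToralEndomorphism.isExactEndomorphism_add_const_of_forall_one_lt_norm M (T := mapMatrix Φ Φ M) (mapMatrix_apply M)
    hexp c

/-- **`det M = ±1` ⟹ no `y ↦ ρ(M) y + c` is exact** (`ι ≠ ∅`). [cite: AndersenThomsen2012, §4 Theorem 4.3 (2) (held text arXiv:1204.0224 chunk p0010)]
[cite: Walters1982, §4.9 Definition 4.14 and the remark after it (held text chunk p0126)] -/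
theorem not_isExactEndomorphism_mapMatrix_add_of_isUnit_det [Nonempty ι] {M : Matrix ι ι ℤ} (hM : IsUnit M.det)
    (c : ComplexTorus Φ) : ¬ IsExactEndomorphism (fun y ↦ mapMatrix Φ Φ M y + c) volume :=
  ToralEndomorphism.not_isExactEndomorphism_add_const_of_isUnit_det M (T := mapMatrix Φ Φ M) (mapMatrix_apply M)
    hM c

/-- **An exact affine map of a complex torus is strong-mixing** (Walters' remark after Definition 4.14, through
Theorem 1.29). [cite: Walters1982, §4.9 remark after Definition 4.14 and §1.7 Theorem 1.29 (held text chunks p0126, p0063)] -/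
theorem mixing_mapMatrix_add_of_isExactEndomorphism {M : Matrix ι ι ℤ} (c : ComplexTorus Φ)
    (h : IsExactEndomorphism (fun y ↦ mapMatrix Φ Φ M y + c) volume) :
    ∀ s t : Set (ComplexTorus Φ), MeasurableSet s → MeasurableSet t →
      Tendsto (fun n : ℕ ↦ volume ((fun y ↦ mapMatrix Φ Φ M y + c)^[n] ⁻¹' s ∩ t)) atTop
        (𝓝 (volume s * volume t)) :=
  (mixing_mapMatrix_add_iff_ergodic Φ c).2 ((isExactEndomorphism_mapMatrix_add_iff Φ c).1 h).ergodic

/-- **An exact endomorphism `ρ(M)` of a complex torus is strong-mixing.**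
[cite: Walters1982, §4.9 remark after Definition 4.14 and §1.7 Theorem 1.29 (held text chunks p0126, p0063)] -/
theorem mixing_mapMatrix_of_isExactEndomorphism {M : Matrix ι ι ℤ} (h : IsExactEndomorphism (mapMatrix Φ Φ M) volume) :
    ∀ s t : Set (ComplexTorus Φ), MeasurableSet s → MeasurableSet t →
      Tendsto (fun n : ℕ ↦ volume ((mapMatrix Φ Φ M)^[n] ⁻¹' s ∩ t)) atTop (𝓝 (volume s * volume t)) := by
  have hS : (fun y ↦ mapMatrix Φ Φ M y + (0 : ComplexTorus Φ)) = mapMatrix Φ Φ M := funext fun y ↦ add_zero _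
  have h' : IsExactEndomorphism (fun y ↦ mapMatrix Φ Φ M y + (0 : ComplexTorus Φ)) volume := by rwa [hS]
  have hmix := mixing_mapMatrix_add_of_isExactEndomorphism Φ 0 h'
  rwa [hS] at hmix

end Literature.Geometry.Kaehler.ComplexTorus

/-! ### §2 Complex abelian varieties: the affine self-maps `g(P) = f(P) · Q` -/

namespace Literature.AlgebraicGeometry.HodgeTheory

open Literature.Geometry.Kaehler

section Affine

variable (A : AbelianVariety ℂ) (f : A ⟶ A) [MeasurableSpace (ComplexPoints A.X)] [BorelSpace (ComplexPoints A.X)]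
  (μ : Measure (ComplexPoints A.X)) [IsProbabilityMeasure μ]
  (hμ : ∀ Q : A.Points ℂ, Measure.map (fun P : A.Points ℂ ↦ P * Q) μ = μ)

include hμ in
/-- **`g(P) = f(P) · Q` is an exact endomorphism iff the covering affine map of the torus is.** For a uniformisation
`φ : X ≃ A(ℂ)` with `f(ℂ) ∘ φ = φ ∘ ρ(M)` one has `g ∘ φ = φ ∘ S`, `S t = ρ(M) t + φ⁻¹Q`
(`semiconj_mapMatrix_add_mapContinuous_mul`), and exactness transports along the measure isomorphism `φ`
(`isExactEndomorphism_conjugate_iff`). [cite: Walters1982, §4.9 Definition 4.14 and §1.7 proof of Theorem 1.29 (held text chunks p0126, p0063)]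
[cite: Lange2023AbelianVarietiesComplex, §1.1.2 Prop. 1.1.6 (PDF p. 19)] -/
theorem isExactEndomorphism_mapContinuous_mul_iff_isExactEndomorphism_mapMatrix_add {ι : Type} [Fintype ι]
    [DecidableEq ι] {E : Type} [NormedAddCommGroup E] [NormedSpace ℂ E] [FiniteDimensional ℂ E]
    {Φ : (ι → ℝ) ≃L[ℝ] E} {φ : ComplexTorus Φ → ComplexPoints A.X} (hφ : IsAnalytification E A.X A.dim φ)
    (hadd : ∀ x y, φ (x + y) = φ x * φ y) {M : Matrix ι ι ℤ}
    (hM : ∀ t, φ (ComplexTorus.mapMatrix Φ Φ M t) = AlgPoints.mapContinuous (L := ℂ) f.hom.hom.hom (φ t))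
    (Q : A.Points ℂ) :
    IsExactEndomorphism (fun P : A.Points ℂ ↦ AlgPoints.mapContinuous (L := ℂ) f.hom.hom.hom P * Q) μ ↔
      IsExactEndomorphism (fun t ↦ ComplexTorus.mapMatrix Φ Φ M t + hφ.homeomorph.symm Q)
        (volume : Measure (ComplexTorus Φ)) := by
  have hsemi := semiconj_mapMatrix_add_mapContinuous_mul A f hφ hadd hM Q
  have hμφ := eq_map_volume_of_map_mul_right_eq A hφ hadd μ hμ
  set e := hφ.homeomorph.toMeasurableEquiv with he
  have hecoe : (e : ComplexTorus Φ → ComplexPoints A.X) = φ := by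
    rw [he, Homeomorph.toMeasurableEquiv_coe, IsAnalytification.coe_homeomorph]
  have hep : MeasurePreserving e volume μ := ⟨e.measurable, by rw [hecoe, hμφ]⟩
  rw [← isExactEndomorphism_conjugate_iff hep]
  refine Iff.of_eq (congrArg (fun T ↦ IsExactEndomorphism T μ) ?_)
  funext P
  change _ = e (ComplexTorus.mapMatrix Φ Φ M (e.symm P) + hφ.homeomorph.symm Q)
  have h1 : e (ComplexTorus.mapMatrix Φ Φ M (e.symm P) + hφ.homeomorph.symm Q) =
      AlgPoints.mapContinuous (L := ℂ) f.hom.hom.hom (e (e.symm P)) * Q := by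
    rw [hecoe]
    exact hsemi (e.symm P)
  rw [h1, e.apply_symm_apply]

include hμ in
/-- **«An affine map is exact if and only if its linear part is», on `A(ℂ)`**: for EVERY endomorphism `f` of a
complex abelian variety and every `Q ∈ A(ℂ)`, the self-map `g(P) = f(P) · Q` is an exact endomorphism of
`(A(ℂ), μ)` iff `f(ℂ)` is (for a non-isogeny neither preserves `μ`).
[cite: AndersenThomsen2012, §4 proof of Theorem 4.3 (held text arXiv:1204.0224 chunk p0010)]
[cite: Walters1982, §4.9 Definition 4.14 (held text chunk p0126)] -/
theorem AbelianVariety.isExactEndomorphism_mapContinuous_mul_iff (Q : A.Points ℂ) :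
    IsExactEndomorphism (fun P : A.Points ℂ ↦ AlgPoints.mapContinuous (L := ℂ) f.hom.hom.hom P * Q) μ ↔
      IsExactEndomorphism (AlgPoints.mapContinuous (L := ℂ) f.hom.hom.hom) μ := by
  obtain ⟨ι, _, _, Φ, φ, hφ, hadd⟩ := complexAbelianVariety_torusUniformised_holds A
  obtain ⟨M, hM⟩ := exists_mapMatrix_comp_eq_of_hom Φ Φ ⟨φ, hφ.isHomeomorph.continuous⟩ hφ hadd
    ⟨φ, hφ.isHomeomorph.continuous⟩ hφ hadd f
  have hM' : ∀ t, φ (ComplexTorus.mapMatrix Φ Φ M t) = AlgPoints.mapContinuous (L := ℂ) f.hom.hom.hom (φ t) :=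
    fun t ↦ hM t
  rw [isExactEndomorphism_mapContinuous_mul_iff_isExactEndomorphism_mapMatrix_add A f μ hμ hφ hadd hM' Q,
    isExactEndomorphism_mapContinuous_iff_isExactEndomorphism_mapMatrix A f μ hμ hφ hadd hM',
    ComplexTorus.isExactEndomorphism_mapMatrix_add_iff Φ]

include hμ in
/-- **Andersen–Thomsen, Theorem 4.3 in measure form on a complex abelian variety**: for an isogeny `f` and every
`Q ∈ A(ℂ)`, `g(P) = f(P) · Q` is an exact endomorphism of `(A(ℂ), μ)` iff no unimodular polynomial divides the
characteristic polynomial of `f(ℂ)^*` on `H¹(A(ℂ); ℚ)`.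
[cite: AndersenThomsen2012, §4 Theorem 4.3 (1)–(2) with Theorem 4.1 (held text arXiv:1204.0224 chunk p0010)]
[cite: Krzyzewski1993, Theorem (abstract)] [cite: Lange2023AbelianVarietiesComplex, §1.1.3 Lemma 1.1.17 (a) (PDF p. 23)] -/
theorem AbelianVariety.isExactEndomorphism_mapContinuous_mul_iff_forall_not_dvd_charpoly
    (hf : Motives.AbelianVariety.IsIsogeny f) (Q : A.Points ℂ) :
    IsExactEndomorphism (fun P : A.Points ℂ ↦ AlgPoints.mapContinuous (L := ℂ) f.hom.hom.hom P * Q) μ ↔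
      ∀ g : ℤ[X], g.Monic → 0 < g.natDegree → IsUnit (g.coeff 0) →
        ¬ g.map (Int.castRingHom ℚ) ∣
          (singularCohomology.map ℚ ℚ (AlgPoints.mapContinuous (L := ℂ) f.hom.hom.hom) 1).hom.charpoly := by
  rw [AbelianVariety.isExactEndomorphism_mapContinuous_mul_iff A f μ hμ Q,
    AbelianVariety.isExactEndomorphism_mapContinuous_iff_forall_not_dvd_charpoly A f μ hμ hf]

include hμ in
/-- **Expanding affine self-maps are exact**: if every eigenvalue of `f(ℂ)^*` on `H¹(A(ℂ); ℚ)` has modulus `> 1`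
then every `g(P) = f(P) · Q` is an exact endomorphism of `(A(ℂ), μ)`.
[cite: AndersenThomsen2012, §4 Theorem 4.3 (1) (held text arXiv:1204.0224 chunk p0010)] -/
theorem AbelianVariety.isExactEndomorphism_mapContinuous_mul_of_forall_one_lt_norm
    (hexp : ∀ α ∈ FrobeniusCharpoly.eigenvalues ℂ
        (singularCohomology.map ℚ ℚ (AlgPoints.mapContinuous (L := ℂ) f.hom.hom.hom) 1).hom, 1 < ‖α‖)
    (Q : A.Points ℂ) :
    IsExactEndomorphism (fun P : A.Points ℂ ↦ AlgPoints.mapContinuous (L := ℂ) f.hom.hom.hom P * Q) μ :=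
  (AbelianVariety.isExactEndomorphism_mapContinuous_mul_iff A f μ hμ Q).2
    (AbelianVariety.isExactEndomorphism_mapContinuous_of_forall_one_lt_norm A f μ hμ hexp)

include hμ in
/-- **No affine self-map `P ↦ f(P) · Q` with `f` an automorphism of a positive-dimensional `A` is exact.**
[cite: AndersenThomsen2012, §4 Theorem 4.3 (2) (held text arXiv:1204.0224 chunk p0010)]
[cite: Walters1982, §4.9 Definition 4.14 and the remark after it (held text chunk p0126)] -/
theorem AbelianVariety.not_isExactEndomorphism_mapContinuous_mul_of_isIso [IsIso f] (hA : 0 < A.dim)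
    (Q : A.Points ℂ) :
    ¬ IsExactEndomorphism (fun P : A.Points ℂ ↦ AlgPoints.mapContinuous (L := ℂ) f.hom.hom.hom P * Q) μ := by
  rw [AbelianVariety.isExactEndomorphism_mapContinuous_mul_iff A f μ hμ Q]
  exact AbelianVariety.not_isExactEndomorphism_mapContinuous_of_isIso A f μ hμ hA

include hμ in
/-- **An exact affine self-map `g(P) = f(P) · Q` of `A(ℂ)` is strong-mixing** (Walters' remark «exact
endomorphisms […] are strong-mixing», verified through Theorem 1.29: `g` exact ⟹ `f(ℂ)` exact ⟹ `f(ℂ)` ergodic ⟹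
`g` strong-mixing, `AbelianVariety.mixing_mapContinuous_mul_iff_ergodic_mapContinuous`).
[cite: Walters1982, §4.9 remark after Definition 4.14 and §1.7 Theorem 1.29 (held text chunks p0126, p0063)] -/
theorem AbelianVariety.mixing_mapContinuous_mul_of_isExactEndomorphism (Q : A.Points ℂ)
    (h : IsExactEndomorphism (fun P : A.Points ℂ ↦ AlgPoints.mapContinuous (L := ℂ) f.hom.hom.hom P * Q) μ) :
    ∀ s t : Set (ComplexPoints A.X), MeasurableSet s → MeasurableSet t →
      Tendsto (fun n : ℕ ↦ μ ((fun P : A.Points ℂ ↦ AlgPoints.mapContinuous (L := ℂ) f.hom.hom.hom P * Q)^[n]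
        ⁻¹' s ∩ t)) atTop (𝓝 (μ s * μ t)) :=
  (AbelianVariety.mixing_mapContinuous_mul_iff_ergodic_mapContinuous A f μ hμ Q).2
    ((AbelianVariety.isExactEndomorphism_mapContinuous_mul_iff A f μ hμ Q).1 h).ergodic

include hμ in
/-- **An exact endomorphism `f(ℂ)` of `A(ℂ)` is strong-mixing** (the case `Q = 1`).
[cite: Walters1982, §4.9 remark after Definition 4.14 and §1.7 Theorem 1.29 (held text chunks p0126, p0063)] -/
theorem AbelianVariety.mixing_mapContinuous_of_isExactEndomorphism
    (h : IsExactEndomorphism (AlgPoints.mapContinuous (L := ℂ) f.hom.hom.hom) μ) :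
    ∀ s t : Set (ComplexPoints A.X), MeasurableSet s → MeasurableSet t →
      Tendsto (fun n : ℕ ↦ μ ((AlgPoints.mapContinuous (L := ℂ) f.hom.hom.hom)^[n] ⁻¹' s ∩ t)) atTop
        (𝓝 (μ s * μ t)) := by
  have hS : (fun P : A.Points ℂ ↦ AlgPoints.mapContinuous (L := ℂ) f.hom.hom.hom P * 1) =
      AlgPoints.mapContinuous (L := ℂ) f.hom.hom.hom := funext fun P ↦ mul_one _
  have h' : IsExactEndomorphism (fun P : A.Points ℂ ↦ AlgPoints.mapContinuous (L := ℂ) f.hom.hom.hom P * 1) μ := by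
    rwa [hS]
  have hmix := AbelianVariety.mixing_mapContinuous_mul_of_isExactEndomorphism A f μ hμ 1 h'
  rwa [hS] at hmix

end Affine

end Literature.AlgebraicGeometry.HodgeTheory
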